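import Mathlib.NumberTheory.LocalField.Basic
import Literature.NumberTheory.Automorphic.AdicCompletionLocalField   -- ★ `instIsNonarchimedeanLocalFieldAdicCompletion`, `instValuativeRelAdicCompletion`
import HarnessLib

/-!
# `𝒪_v = 𝒪[K_v]` is `𝔪_v`-adically complete — in Mathlib's `Valued` spelling of the integers of `K_v = v.adicCompletion K`

Topic `NumberTheory/Automorphic`; namespace `Literature.NumberTheory.Automorphic`.  THEOREMS ONLY (no definition, no instance, no notation), kernel lane;
imports Mathlib `NumberTheory.LocalField.Basic` + ★ `AdicCompletionLocalField` only; the two heads are re-registered as `instance`s in the companion module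
`AdicCompletionIntegersAdicCompleteInstances` (definition lane) — until it lands, consumers write `haveI := isAdicComplete_maximalIdeal_valuedInteger_adicCompletion L w`.  Cell `hodgecm-mathlib`, F0∕P3a road «D-N7-inert»
(pay-down line `Cruxes/H413/Lines/F0_P3a_N7nsCount.lean` ED. 1.5, the six per-class value stubs), seat F0P3b-p01 (g7).

WHY.  The Flicker-type local counting files of the tree (★ `UnitOrbitalIntegralInertCountTH`, ★ `…InertValueThetaZeroCorner`, ★
`…InertValueThetaZeroTrichotomy`, ★ `UnitaryThreeAnisotropicNormalForm`, … ≈ 20 modules) work over an ABSTRACT complete discretely valued field `K`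
in Mathlib's `Valued` currency and carry the instance binders `[IsDiscreteValuationRing 𝒪[K]] [Finite 𝓀[K]] [IsAdicComplete 𝓂[K] 𝒪[K]]`.  At the
instantiation `K = L_w = w.adicCompletion L` (a number field `L`, a finite place `w`) the first two are found by class inference, but the third is NOT:
Mathlib proves `IsAdicComplete 𝓂[K] 𝒪[K]` only for `[IsNonarchimedeanLocalField K]` in the `ValuativeRel` currency
(`𝒪[K] = (ValuativeRel.valuation K).integer`, `NumberTheory/LocalField/Basic.lean`), and although ★ `AdicCompletionLocalField` makes `K_v` such a local
field, the `ValuativeRel` integers and the `Valued` integers `Valued.v.integer` of `K_v` are two syntactically different subrings.  Hence the HONEST BINDER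
`[IsAdicComplete (IsLocalRing.maximalIdeal 𝒪[w.1.adicCompletion L]) 𝒪[w.1.adicCompletion L]]` of ★ `UnitOrbitalIntegralInertValueThetaZeroAdicCompletion`
(F0P3a-p04 (g12)).  This file DISCHARGES it once and for all:

* (private) `IsAdicComplete.of_subring_eq` — transport of `𝔪`-adic completeness along an EQUALITY of subrings `A = B` of a commutative ring (both local);
* `integer_valuation_eq_valuedInteger` — for any Dedekind domain `R` with fraction field `K` and finite place `v`:
  `(ValuativeRel.valuation K_v).integer = 𝒪[K_v]` (`Valued` spelling; the two unit balls coincide because `Valued.v` is compatible with the valuative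
  relation it defines, Mathlib `Valuation.vle_one_iff`); note `(v.adicCompletionIntegers K).toSubring = 𝒪[K_v]` is `rfl` (Mathlib's `adicCompletionIntegers`
  IS the `Valued` unit ball `Valued.v.valuationSubring`);
* **`isAdicComplete_maximalIdeal_valuedInteger_adicCompletion`** — for a number field `K`: `IsAdicComplete 𝓂[K_v] 𝒪[K_v]` in the `Valued` spelling
  (Mathlib's local-field instance, fired by ★ `instIsNonarchimedeanLocalFieldAdicCompletion` and the completion's `IsUniformAddGroup`, transported by the
  two lemmas above), and the same for the subtype of Mathlib's `v.adicCompletionIntegers K` (**`isAdicComplete_maximalIdeal_adicCompletionIntegers`**);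
  `isAdicComplete_valuedMaximalIdeal_valuedInteger_adicCompletion` is the `Valued.maximalIdeal` spelling `IsAdicComplete 𝓂[K_v] 𝒪[K_v]`.

Mathematically this is the classical fact that the valuation ring of the completion of a global field at a finite place is complete for its
`𝔪`-adic topology (Serre, *Local Fields*, Ch. II §1; Cassels–Fröhlich Ch. II §7); no new mathematics — a currency bridge.  HONEST LABEL (cell rule):
HC_CM is proved only modulo the 2 remaining named inputs (hLiu418, h413) until rung 0 closes; this file is unconditional and Mathlib-footed.

Tree ∕ Mathlib search: Mathlib `IsNonarchimedeanLocalField` instances `CompleteSpace 𝒪[K]`, `IsAdicComplete 𝓂[K] 𝒪[K]` (`[UniformSpace K] [IsUniformAddGroup K]`);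
★ `Literature.NumberTheory.GaloisRepresentations.LocalField.isAdicComplete_maximalIdeal` (the `TopologicalSpace` spelling, still `ValuativeRel` currency);
★ `integer_valuation_eq_adicCompletionIntegers` (`UnitaryGroupIntegralPointsReductionInert`, heavy import closure — re-proved here in 3 lines under a new name);
`rg -n "IsAdicComplete" Literature/NumberTheory/Automorphic Literature/NumberTheory/Rogawski1990` — only binders, no instance for `adicCompletion`.

## References
* [SerreLocalFields1979] J.-P. Serre, *Local Fields* (GTM 67, 1979), Ch. II §1.
* J. W. S. Cassels, A. Fröhlich (eds.), *Algebraic Number Theory* (1967), Ch. II §7.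
-/

set_option autoImplicit false

namespace Literature.NumberTheory.Automorphic

open IsDedekindDomain

section Transport

/-- **Transport of `𝔪`-adic completeness along an equality of subrings** (private plumbing).  If `A = B` as subrings of a commutative ring `R` and
`A` (a local ring) is complete for its maximal-ideal-adic topology, so is `B` (the two `IsLocalRing` instances may be syntactically unrelated: they are
propositions). [folklore] -/
private theorem IsAdicComplete.of_subring_eq {R : Type*} [CommRing R] {A B : Subring R} (h : A = B)
    [IsLocalRing A] [IsLocalRing B] [hA : IsAdicComplete (IsLocalRing.maximalIdeal A) A] :
    IsAdicComplete (IsLocalRing.maximalIdeal B) B := by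
  subst h
  exact hA

end Transport

section Dedekind

open scoped Valued

variable {R : Type*} [CommRing R] [IsDedekindDomain R] (K : Type*) [Field K] [Algebra R K]
  [IsFractionRing R K] (v : HeightOneSpectrum R)

/-- **The `ValuativeRel` integers of `K_v` are its `Valued` integers**: `(ValuativeRel.valuation K_v).integer = 𝒪[K_v] = Valued.v.integer`
(the valuative relation of `K_v` is the one defined by `Valued.v`, ★ `instValuativeRelAdicCompletion`, and `Valued.v` is compatible with it, so the two
closed unit balls coincide — Mathlib `Valuation.vle_one_iff`).  Same content as ★ `integer_valuation_eq_adicCompletionIntegers` (stated there against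
`(v.adicCompletionIntegers K).toSubring`), re-proved to keep the import closure at ★ `AdicCompletionLocalField`. [cite: SerreLocalFields1979, Ch. II §1] -/
theorem integer_valuation_eq_valuedInteger :
    (ValuativeRel.valuation (v.adicCompletion K)).integer = 𝒪[v.adicCompletion K] := by
  ext x
  rw [Valuation.mem_integer_iff, Valued.integer, Valuation.mem_integer_iff,
    ← Valuation.vle_one_iff (ValuativeRel.valuation (v.adicCompletion K)),
    Valuation.vle_one_iff (Valued.v : Valuation (v.adicCompletion K) (WithZero (Multiplicative ℤ)))]

end Dedekind

section NumberField

open scoped Valued _root_.NumberField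

variable (K : Type*) [Field K] [NumberField K] (v : HeightOneSpectrum (𝓞 K))

/-- **`𝒪[K_v]` is `𝓂[K_v]`-adically complete** (Mathlib's `Valued` spelling `𝒪[K_v] = Valued.v.integer`), for a number field `K` and a finite place `v`:
Mathlib's instance `IsNonarchimedeanLocalField K_v → IsAdicComplete 𝓂[K_v] 𝒪[K_v]` (in the `ValuativeRel` spelling; the local-field structure of `K_v` is
★ `instIsNonarchimedeanLocalFieldAdicCompletion`, the uniform structure is the completion's) transported along `integer_valuation_eq_valuedInteger`.
This discharges the binder `[IsAdicComplete (IsLocalRing.maximalIdeal 𝒪[w.1.adicCompletion L]) 𝒪[w.1.adicCompletion L]]` of ★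
`natCard_fixedPoints_unitaryInt_corner_eq_phiZero_adicCompletion` and of every `K = L_w` instantiation of the abstract Flicker-type counting files.
[cite: SerreLocalFields1979, Ch. II §1] -/
theorem isAdicComplete_maximalIdeal_valuedInteger_adicCompletion :
    IsAdicComplete (IsLocalRing.maximalIdeal 𝒪[v.adicCompletion K]) 𝒪[v.adicCompletion K] :=
  IsAdicComplete.of_subring_eq (integer_valuation_eq_valuedInteger K v)

/-- The `Valued.maximalIdeal` spelling `IsAdicComplete 𝓂[K_v] 𝒪[K_v]` of `isAdicComplete_maximalIdeal_valuedInteger_adicCompletion` (the two maximal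
ideals are the same term up to the reducible abbreviation `Valued.maximalIdeal`). [cite: SerreLocalFields1979, Ch. II §1] -/
theorem isAdicComplete_valuedMaximalIdeal_valuedInteger_adicCompletion :
    IsAdicComplete 𝓂[v.adicCompletion K] 𝒪[v.adicCompletion K] :=
  isAdicComplete_maximalIdeal_valuedInteger_adicCompletion K v

/-- **`v.adicCompletionIntegers K` is complete for its maximal-ideal-adic topology** — the same fact for the subtype of Mathlib's
`ValuationSubring` `v.adicCompletionIntegers K` (whose underlying subring is `𝒪[K_v]` definitionally).
[cite: SerreLocalFields1979, Ch. II §1] -/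
theorem isAdicComplete_maximalIdeal_adicCompletionIntegers :
    IsAdicComplete (IsLocalRing.maximalIdeal (v.adicCompletionIntegers K)) (v.adicCompletionIntegers K) :=
  isAdicComplete_maximalIdeal_valuedInteger_adicCompletion K v

end NumberField

end Literature.NumberTheory.Automorphic
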